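import Literature.NumberTheory.EllipticCurves.BinaryQuarticPointedNormalForms
import HarnessLib

/-!
# Monic binary quartic forms `x⁴ + c x²y² + d xy³ + e y⁴` with given invariants, and the injection
# of the points of `z² = f(x, 1)` into them (any field with `2 ≠ 0`, `3 ≠ 0`)

Topic `Literature/NumberTheory/EllipticCurves`; continues `BinaryQuarticPointedNormalForms.lean`.
Second file of the elementary proof that binary quartic forms with nonzero discriminant over a
finite field of characteristic `≥ 5` are soluble (the input "`p ∤ Δ(f)` ⇒ `f` is `ℚ_p`-soluble"
of Bhargava–Shankar, Ann. of Math. 181 (2015), Prop. 5.13 of `arXiv:1006.1002v2` / Prop. 3.18 of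
the published version). It concerns the normal forms reached in the first file:

* `BinaryQuartic.monicForm I c d = (1, 0, c, d, (I − c²)/12)`, the monic form with `b = 0`,
  middle coefficients `(c, d)` and invariant `I` (`I_monicForm`); its invariant `J` is
  `6cI − 8c³ − 27d²` (`J_monicForm`), so the monic `b = 0` forms with invariants `(I, J)` are
  parametrised by `BinaryQuartic.curvePairs I J = {(c, d) : 27d² = 6cI − 8c³ − J}` — an affine
  cubic isomorphic to `E_{I,J} : z² = x³ − (I/3)x − J/27` by `(x, z) ↦ (−3x/2, z)`
  (`mem_curvePairs_iff_of_point`; in characteristic `0` `monicForm I (−3ξ/2) η` is the form `f_P`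
  of `BhargavaShankarSolubleOrbits.lean`);
* for `f = monicForm I c d` with `J(f) = J` and `4I³ ≠ J²`, the map
  `ρ_f (x, z) = (−3z − 3x² − c/2, 4xz + 4x³ + 2cx + d)` sends the solutions of `z² = f(x, 1)`
  **injectively** into `curvePairs I J`, **missing the pair `(c, −d)`** (`rho_mem_curvePairs`,
  `rho_injOn`, `rho_ne`). (This is the trivialisation `C_f ≅ E_{I,J}`, `p ↦ p − p₀`, of Cremona
  2001, Prop. 4.3 (5), in coordinates free of the group law; cf. `BinaryQuartic.torsorX/torsorY` of
  `BhargavaShankarSolubleCosets.lean` in characteristic `0`.) Consequently, over a finite field,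
  `#{(x, z) : z² = f(x,1)} ≤ #curvePairs I J − 1` (`ncard_affinePoints_le`).

## References

* [BhargavaShankarAnnals2015] Prop. 5.13, proof (arXiv:1006.1002v2 numbering).
  [cite: BhargavaShankarAnnals2015, Prop. 5.13, proof (arXiv:1006.1002v2 numbering)]
* J. E. Cremona, J. Symbolic Comput. 31 (2001), Prop. 4.3 (5). [cite: Cremona2001, Prop. 4.3]
-/

noncomputable section

open scoped Classical

namespace Literature.NumberTheory.EllipticCurves

namespace BinaryQuartic

variable {K : Type*} [Field K]

/-! ## Numerals -/

/-- `4 ≠ 0` from `2 ≠ 0`. [folklore] -/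
private theorem four_ne (h2 : (2 : K) ≠ 0) : (4 : K) ≠ 0 := by
  rw [show (4 : K) = 2 * 2 by norm_num]; exact mul_ne_zero h2 h2

/-- `12 ≠ 0` from `2 ≠ 0`, `3 ≠ 0`. [folklore] -/
private theorem twelve_ne (h2 : (2 : K) ≠ 0) (h3 : (3 : K) ≠ 0) : (12 : K) ≠ 0 := by
  rw [show (12 : K) = 2 * 2 * 3 by norm_num]; exact mul_ne_zero (mul_ne_zero h2 h2) h3

/-- `27 ≠ 0` from `3 ≠ 0`. [folklore] -/
private theorem twentySeven_ne (h3 : (3 : K) ≠ 0) : (27 : K) ≠ 0 := by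
  rw [show (27 : K) = 3 * 3 * 3 by norm_num]; exact mul_ne_zero (mul_ne_zero h3 h3) h3

/-! ## Monic forms with `b = 0` -/

/-- The monic form `x⁴ + c x²y² + d xy³ + ((I − c²)/12) y⁴` — the unique monic form with `b = 0`,
middle coefficients `(c, d)` and invariant `I`. [folklore] -/
def monicForm (I c d : K) : BinaryQuartic K :=
  ⟨1, 0, c, d, (I - c ^ 2) / 12⟩

/-- `monicForm` is monic (definitional). [folklore] -/
@[simp] theorem monicForm_a (I c d : K) : (monicForm I c d).a = 1 := rfl
/-- `monicForm` has `b = 0` (definitional). [folklore] -/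
@[simp] theorem monicForm_b (I c d : K) : (monicForm I c d).b = 0 := rfl
/-- The coefficient `c` (definitional). [folklore] -/
@[simp] theorem monicForm_c (I c d : K) : (monicForm I c d).c = c := rfl
/-- The coefficient `d` (definitional). [folklore] -/
@[simp] theorem monicForm_d (I c d : K) : (monicForm I c d).d = d := rfl
/-- The coefficient `e = (I − c²)/12` (definitional). [folklore] -/
@[simp] theorem monicForm_e (I c d : K) : (monicForm I c d).e = (I - c ^ 2) / 12 := rfl

/-- `I(monicForm I c d) = I` (`2 ≠ 0`, `3 ≠ 0`). [folklore] -/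
theorem I_monicForm (h2 : (2 : K) ≠ 0) (h3 : (3 : K) ≠ 0) (I c d : K) : (monicForm I c d).I = I := by
  have h12 := twelve_ne h2 h3
  simp only [BinaryQuartic.I, monicForm]
  field_simp
  ring

/-- `J(monicForm I c d) = 6cI − 8c³ − 27d²` (`2 ≠ 0`, `3 ≠ 0`). [folklore] -/
theorem J_monicForm (h2 : (2 : K) ≠ 0) (h3 : (3 : K) ≠ 0) (I c d : K) :
    (monicForm I c d).J = 6 * c * I - 8 * c ^ 3 - 27 * d ^ 2 := by
  have h12 := twelve_ne h2 h3
  simp only [BinaryQuartic.J, monicForm]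
  field_simp
  ring

/-- A monic form with `b = 0` is `monicForm I(f) c d` (`2 ≠ 0`, `3 ≠ 0`). [folklore] -/
theorem eq_monicForm (h2 : (2 : K) ≠ 0) (h3 : (3 : K) ≠ 0) {f : BinaryQuartic K} (ha : f.a = 1)
    (hb : f.b = 0) : f = monicForm f.I f.c f.d := by
  have h12 := twelve_ne h2 h3
  ext
  · simp [ha]
  · simp [hb]
  · simp
  · simp
  · simp only [monicForm_e, BinaryQuartic.I, ha, hb]; field_simp; ring

/-- The value `f(x, 1) = x⁴ + cx² + dx + (I − c²)/12` of a monic form. [folklore] -/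
theorem eval_monicForm_one (I c d x : K) :
    (monicForm I c d).eval x 1 = x ^ 4 + c * x ^ 2 + d * x + (I - c ^ 2) / 12 := by
  simp only [eval, monicForm]; ring

/-- The set of monic `b = 0` forms with invariants `(I, J)`, in the coordinates `(c, d)`:
`{(c, d) : 6cI − 8c³ − 27d² = J}` (an affine model of `E_{I,J}`, see
`mem_curvePairs_iff_of_point`). [folklore] -/
def curvePairs (I J : K) : Set (K × K) :=
  {cd | 6 * cd.1 * I - 8 * cd.1 ^ 3 - 27 * cd.2 ^ 2 = J}

/-- Membership in `curvePairs` (unfolding). [folklore] -/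
theorem mem_curvePairs_iff (I J c d : K) :
    (c, d) ∈ curvePairs I J ↔ 6 * c * I - 8 * c ^ 3 - 27 * d ^ 2 = J := Iff.rfl

/-- `(c, d) ∈ curvePairs I J` iff `monicForm I c d` has invariants `(I, J)`. [folklore] -/
theorem mem_curvePairs_iff_J (h2 : (2 : K) ≠ 0) (h3 : (3 : K) ≠ 0) (I J c d : K) :
    (c, d) ∈ curvePairs I J ↔ (monicForm I c d).J = J := by
  rw [mem_curvePairs_iff, J_monicForm h2 h3]

/-- `(c, −d) ∈ curvePairs I J` along with `(c, d)`. [folklore] -/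
theorem neg_mem_curvePairs {I J c d : K} (h : (c, d) ∈ curvePairs I J) : (c, -d) ∈ curvePairs I J := by
  rw [mem_curvePairs_iff] at h ⊢
  rw [← h]; ring

/-- **`curvePairs I J` is an affine model of `E_{I,J}`**: `(−3x/2, z) ∈ curvePairs I J` iff
`z² = x³ − (I/3)x − J/27` (`2 ≠ 0`, `3 ≠ 0`). [folklore] -/
theorem mem_curvePairs_iff_of_point (h2 : (2 : K) ≠ 0) (h3 : (3 : K) ≠ 0) (I J x z : K) :
    (-3 * x / 2, z) ∈ curvePairs I J ↔ z ^ 2 = x ^ 3 - I / 3 * x - J / 27 := by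
  have h27 := twentySeven_ne h3
  have e1 : 6 * (-3 * x / 2) * I = -9 * x * I := by field_simp; ring
  have e2 : 8 * (-3 * x / 2) ^ 3 = -27 * x ^ 3 := by field_simp; ring
  rw [mem_curvePairs_iff, e1, e2]
  constructor
  · intro h
    -- `h : -9xI + 27x³ − 27z² = J`
    have h81 : (27 : K) * (3 * z ^ 2) = 27 * (3 * x ^ 3 - I * x) - 3 * J := by
      linear_combination -3 * h
    field_simp
    linear_combination h81
  · intro h
    have h' : (3 : K) * (-9 * x * I - -27 * x ^ 3 - 27 * z ^ 2) = 3 * J := by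
      field_simp at h
      linear_combination -h
    exact mul_left_cancel₀ h3 h'

/-- `(x, z) ↦ (−3x/2, z)` is injective (`2 ≠ 0`, `3 ≠ 0`). [folklore] -/
theorem pointToPair_injective (h2 : (2 : K) ≠ 0) (h3 : (3 : K) ≠ 0) :
    Function.Injective fun p : K × K ↦ (-3 * p.1 / 2, p.2) := by
  intro p q h
  simp only [Prod.mk.injEq] at h
  obtain ⟨h1, h2'⟩ := h
  have : p.1 = q.1 := by
    field_simp at h1
    linear_combination -h1
  exact Prod.ext this h2'

/-- The affine points of `E_{I,J}` correspond to `curvePairs I J`: the image of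
`{(x, z) : z² = x³ − (I/3)x − J/27}` under `(x, z) ↦ (−3x/2, z)` is `curvePairs I J`. [folklore] -/
theorem image_pointToPair (h2 : (2 : K) ≠ 0) (h3 : (3 : K) ≠ 0) (I J : K) :
    (fun p : K × K ↦ (-3 * p.1 / 2, p.2)) '' {p | p.2 ^ 2 = p.1 ^ 3 - I / 3 * p.1 - J / 27} =
      curvePairs I J := by
  ext ⟨c, d⟩
  constructor
  · rintro ⟨⟨x, z⟩, hp, h⟩
    simp only [Prod.mk.injEq] at h
    obtain ⟨rfl, rfl⟩ := h
    exact (mem_curvePairs_iff_of_point h2 h3 I J x z).mpr hp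
  · intro h
    have hc : -3 * (-2 * c / 3) / 2 = c := by field_simp
    refine ⟨(-2 * c / 3, d), ?_, Prod.ext hc rfl⟩
    show d ^ 2 = (-2 * c / 3) ^ 3 - I / 3 * (-2 * c / 3) - J / 27
    have h' : (-3 * (-2 * c / 3) / 2, d) ∈ curvePairs I J := by rw [hc]; exact h
    exact (mem_curvePairs_iff_of_point h2 h3 I J _ d).mp h'

/-! ## The injection `ρ_f` of the points of `z² = f(x,1)` into `curvePairs` -/

/-- The solutions `(x, z)` of `z² = f(x, 1)` (affine points of `C_f` in the chart `y = 1`). [folklore] -/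
def affinePoints (f : BinaryQuartic K) : Set (K × K) :=
  {p | p.2 ^ 2 = f.eval p.1 1}

/-- Membership in `affinePoints` (unfolding). [folklore] -/
theorem mem_affinePoints_iff (f : BinaryQuartic K) (x z : K) :
    (x, z) ∈ affinePoints f ↔ z ^ 2 = f.eval x 1 := Iff.rfl

/-- `ρ_f(x, z) = (−3z − 3x² − c/2, 4xz + 4x³ + 2cx + d)` for `f = (1, 0, c, d, e)`: the monic
`b = 0` normal form of the pointed form `(f; (x, 1, z))`, in the coordinates `(c, d)` (Cremona
2001, Prop. 4.3 (5), made explicit). [cite: Cremona2001, Prop. 4.3] -/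
def rho (c d : K) (p : K × K) : K × K :=
  (-3 * p.2 - 3 * p.1 ^ 2 - c / 2, 4 * p.1 * p.2 + 4 * p.1 ^ 3 + 2 * c * p.1 + d)

/-- **`ρ_f` lands in `curvePairs I J`** when `(x, z)` solves `z² = f(x,1)`, `f = monicForm I c d`
with `J(f) = J` (the identity `W² − (X³ − (I/3)X − J/27) = 4(f(x,1) − z²)(X − ξ)` of the
characteristic-`0` theory, in the present coordinates). [cite: Cremona2001, Prop. 4.3] -/
theorem rho_mem_curvePairs (h2 : (2 : K) ≠ 0) (h3 : (3 : K) ≠ 0) {I J c d : K}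
    (hcd : (c, d) ∈ curvePairs I J) {x z : K} (hxz : (x, z) ∈ affinePoints (monicForm I c d)) :
    rho c d (x, z) ∈ curvePairs I J := by
  have h12 := twelve_ne h2 h3
  rw [mem_affinePoints_iff, eval_monicForm_one] at hxz
  rw [mem_curvePairs_iff] at hcd ⊢
  simp only [rho]
  have hI : I = 12 * (z ^ 2 - x ^ 4 - c * x ^ 2 - d * x) + c ^ 2 := by
    field_simp at hxz; linear_combination -hxz
  rw [← hcd, hI]
  field_simp
  ring

/-- The middle coefficient of `ρ_f(x, z)` determines `z`: `3z = −c' − 3x² − c/2`. [folklore] -/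
theorem rho_fst_eq (c d x z : K) : 3 * z = -(rho c d (x, z)).1 - 3 * x ^ 2 - c / 2 := by
  simp only [rho]; ring

/-- The second coordinate of `ρ_f` is affine-linear in `x` once `c'` is fixed:
`3 d' = 4(c − c')x + 3d`. [folklore] -/
theorem rho_snd_eq (h2 : (2 : K) ≠ 0) (c d x z : K) :
    3 * (rho c d (x, z)).2 = 4 * (c - (rho c d (x, z)).1) * x + 3 * d := by
  simp only [rho]; field_simp; ring

/-- If `I = 4c²` then `4I³ = J(monicForm I c 0)²`: the form `x⁴ + cx²y² + (c²/4)y⁴ = (x² + (c/2)y²)²`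
has `4I³ = J²` (i.e. `Δ = 0`). [folklore] -/
theorem four_I_cube_eq_of_square (h2 : (2 : K) ≠ 0) (h3 : (3 : K) ≠ 0) {I c : K}
    (hI : I = 4 * c ^ 2) : 4 * I ^ 3 = (monicForm I c 0).J ^ 2 := by
  rw [J_monicForm h2 h3, hI]
  ring

/-- The key computation in the chart `c' = c`: if `(−x² − c/2)² = x⁴ + cx² + dx + (I − c²)/12`
then `12dx = 4c² − I`. [folklore] -/
theorem twelve_mul_eq_of_sq_eq (h2 : (2 : K) ≠ 0) (h3 : (3 : K) ≠ 0) {I c d x : K}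
    (hx : (-x ^ 2 - c / 2) ^ 2 = x ^ 4 + c * x ^ 2 + d * x + (I - c ^ 2) / 12) :
    12 * (d * x) = 4 * c ^ 2 - I := by
  have h4 := four_ne h2
  have h12 := twelve_ne h2 h3
  have e1 : (-x ^ 2 - c / 2) ^ 2 = x ^ 4 + c * x ^ 2 + c ^ 2 / 4 := by field_simp; ring
  rw [e1] at hx
  have hx' : c ^ 2 / 4 = d * x + (I - c ^ 2) / 12 := by linear_combination hx
  have : (12 : K) * (c ^ 2 / 4) = 12 * (d * x + (I - c ^ 2) / 12) := by rw [hx']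
  have e2 : (12 : K) * (c ^ 2 / 4) = 3 * c ^ 2 := by field_simp; ring
  have e3 : (12 : K) * (d * x + (I - c ^ 2) / 12) = 12 * (d * x) + (I - c ^ 2) := by field_simp
  rw [e2, e3] at this
  linear_combination -this

/-- From `3z = −c − 3x² − c/2`, `z = −x² − c/2`. [folklore] -/
theorem z_eq_of_three_mul (h2 : (2 : K) ≠ 0) (h3 : (3 : K) ≠ 0) {c x z : K}
    (hz : 3 * z = -c - 3 * x ^ 2 - c / 2) : z = -x ^ 2 - c / 2 := by
  have h' : (3 : K) * z = 3 * (-x ^ 2 - c / 2) := by rw [hz]; field_simp; ring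
  exact mul_left_cancel₀ h3 h'

/-- **`ρ_f` is injective** on the solutions of `z² = f(x,1)`, for `f = monicForm I c d` with
`J(f) = J` and `4I³ ≠ J²`. (If `c'` differs from `c`, `x` is recovered from `d'`; if `c' = c` then
`z = −x² − c/2` and `dx = c²/4 − e` with `d ≠ 0`.) [cite: Cremona2001, Prop. 4.3] -/
theorem rho_injOn (h2 : (2 : K) ≠ 0) (h3 : (3 : K) ≠ 0) {I J c d : K} (hΔ : 4 * I ^ 3 ≠ J ^ 2)
    (hcd : (c, d) ∈ curvePairs I J) :
    Set.InjOn (rho c d) (affinePoints (monicForm I c d)) := by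
  have h4 := four_ne h2
  have h12 := twelve_ne h2 h3
  have hJ : (monicForm I c d).J = J := (mem_curvePairs_iff_J h2 h3 I J c d).mp hcd
  rintro ⟨x₁, z₁⟩ h₁ ⟨x₂, z₂⟩ h₂ heq
  rw [mem_affinePoints_iff, eval_monicForm_one] at h₁ h₂
  have hz₁ := rho_fst_eq c d x₁ z₁
  have hz₂ := rho_fst_eq c d x₂ z₂
  have hd₁ := rho_snd_eq h2 c d x₁ z₁
  have hd₂ := rho_snd_eq h2 c d x₂ z₂
  rw [heq] at hz₁ hd₁
  set c' := (rho c d (x₂, z₂)).1 with hc'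
  set d' := (rho c d (x₂, z₂)).2 with hd'
  by_cases hc : c' = c
  · -- `c' = c`: then `z = −x² − c/2` for both points and `12 d x = 4c² − I`
    rw [hc] at hz₁ hz₂ hd₁ hd₂
    have hzx₁ : z₁ = -x₁ ^ 2 - c / 2 := z_eq_of_three_mul h2 h3 hz₁
    have hzx₂ : z₂ = -x₂ ^ 2 - c / 2 := z_eq_of_three_mul h2 h3 hz₂
    rw [hzx₁] at h₁
    rw [hzx₂] at h₂
    have k₁ := twelve_mul_eq_of_sq_eq h2 h3 h₁
    have k₂ := twelve_mul_eq_of_sq_eq h2 h3 h₂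
    have hd0 : d ≠ 0 := by
      intro hd0
      rw [hd0, zero_mul, mul_zero] at k₁
      apply hΔ
      rw [← hJ, hd0]
      exact four_I_cube_eq_of_square h2 h3 (by linear_combination k₁)
    have hdx : d * x₁ = d * x₂ := mul_left_cancel₀ h12 (by rw [k₁, k₂])
    have hx : x₁ = x₂ := mul_left_cancel₀ hd0 hdx
    subst hx
    rw [Prod.mk.injEq]
    exact ⟨rfl, by rw [hzx₁, hzx₂]⟩
  · -- `c' ≠ c`: `x` is determined by `d'`
    have hcc : (c - c' : K) ≠ 0 := sub_ne_zero.mpr (Ne.symm hc)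
    have hx : x₁ = x₂ := by
      have h : 4 * (c - c') * x₁ = 4 * (c - c') * x₂ := by linear_combination hd₂ - hd₁
      exact mul_left_cancel₀ (mul_ne_zero h4 hcc) h
    subst hx
    have hz : z₁ = z₂ := by
      have h : (3 : K) * z₁ = 3 * z₂ := by rw [hz₁, hz₂]
      exact mul_left_cancel₀ h3 h
    rw [hz]

/-- **`ρ_f` misses `(c, −d)`** (the pair of `−P`, image of the second point at infinity): for
`f = monicForm I c d` with `J(f) = J`, `4I³ ≠ J²`. [cite: Cremona2001, Prop. 4.3] -/
theorem rho_ne (h2 : (2 : K) ≠ 0) (h3 : (3 : K) ≠ 0) {I J c d : K} (hΔ : 4 * I ^ 3 ≠ J ^ 2)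
    (hcd : (c, d) ∈ curvePairs I J) {x z : K} (hxz : (x, z) ∈ affinePoints (monicForm I c d)) :
    rho c d (x, z) ≠ (c, -d) := by
  have h12 := twelve_ne h2 h3
  have hJ : (monicForm I c d).J = J := (mem_curvePairs_iff_J h2 h3 I J c d).mp hcd
  intro h
  rw [mem_affinePoints_iff, eval_monicForm_one] at hxz
  have hz := rho_fst_eq c d x z
  have hd' := rho_snd_eq h2 c d x z
  rw [h] at hz hd'
  simp only at hz hd'
  rw [sub_self, mul_zero, zero_mul, zero_add] at hd'
  -- `−3d = 3d`, so `d = 0`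
  have hd0 : d = 0 := by
    have h6 : (6 : K) ≠ 0 := by
      rw [show (6 : K) = 2 * 3 by norm_num]; exact mul_ne_zero h2 h3
    have : (6 : K) * d = 0 := by linear_combination -hd'
    exact (mul_eq_zero.mp this).resolve_left h6
  have hzx : z = -x ^ 2 - c / 2 := z_eq_of_three_mul h2 h3 hz
  rw [hzx] at hxz
  have k := twelve_mul_eq_of_sq_eq h2 h3 hxz
  rw [hd0, zero_mul, mul_zero] at k
  apply hΔ
  rw [← hJ, hd0]
  exact four_I_cube_eq_of_square h2 h3 (by linear_combination k)

/-- The image of `ρ_f` lies in `curvePairs I J ∖ {(c, −d)}`. [cite: Cremona2001, Prop. 4.3] -/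
theorem rho_image_subset (h2 : (2 : K) ≠ 0) (h3 : (3 : K) ≠ 0) {I J c d : K} (hΔ : 4 * I ^ 3 ≠ J ^ 2)
    (hcd : (c, d) ∈ curvePairs I J) :
    rho c d '' affinePoints (monicForm I c d) ⊆ curvePairs I J \ {(c, -d)} := by
  rintro _ ⟨⟨x, z⟩, hxz, rfl⟩
  exact ⟨rho_mem_curvePairs h2 h3 hcd hxz, rho_ne h2 h3 hΔ hcd hxz⟩

/-- **Over a finite field, `#{(x, z) : z² = f(x, 1)} ≤ #curvePairs I J − 1`** for a monic
`b = 0` form `f` with invariants `(I, J)`, `4I³ ≠ J²`. [cite: Cremona2001, Prop. 4.3] -/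
theorem ncard_affinePoints_le [Finite K] (h2 : (2 : K) ≠ 0) (h3 : (3 : K) ≠ 0) {I J c d : K}
    (hΔ : 4 * I ^ 3 ≠ J ^ 2) (hcd : (c, d) ∈ curvePairs I J) :
    (affinePoints (monicForm I c d)).ncard + 1 ≤ (curvePairs I J).ncard := by
  have hfin : (curvePairs I J).Finite := Set.toFinite _
  have himg := rho_image_subset h2 h3 hΔ hcd
  have hinj := rho_injOn h2 h3 hΔ hcd
  rw [← hinj.ncard_image]
  have hmem : (c, -d) ∈ curvePairs I J := neg_mem_curvePairs hcd
  calc (rho c d '' affinePoints (monicForm I c d)).ncard + 1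
      ≤ (curvePairs I J \ {(c, -d)}).ncard + 1 :=
        Nat.add_le_add_right (Set.ncard_le_ncard himg (Set.toFinite _)) 1
    _ = (curvePairs I J).ncard := by
        rw [Set.ncard_sdiff_singleton_add_one hmem hfin]

end BinaryQuartic

end Literature.NumberTheory.EllipticCurves

end
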